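import Summits.ValiantsHypothesis.ValiantsHypothesis.Theorems.KPlusLogSqLawTridiagonalRealStaticUnitPencilDefs
import Summits.ValiantsHypothesis.ValiantsHypothesis.Theorems.KPlusLogSqLawTridiagonalRealStaticUnitWronskian
import Summits.ValiantsHypothesis.ValiantsHypothesis.Theorems.KPlusLogSqLawTridiagonalSturmCertificate

/-!
# Route «KPlusLogSqLaw», crux `WeakLifting` (stmt-ValiantsHypothesis-19561) — REAL side of the tridiagonal sector:
# the UNIT-COEFFICIENT sub-sector as a LACUNARY PENCIL — matrix, determinant, kernel, quadratic form, Rayleigh derivative (all sizes)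

HONEST FRAMING.  Helper theorems (`--supports stmt-ValiantsHypothesis-19561 --as helper`), seat val-sym-lift-p1 (g18), cell `pub-symmetroid`,
2026-08-28; the bookkeeping half of the BRIDGE from this seat's crossing-direction package (p632571 → p633123 → p633729 → p635395) to
val-sym-mdr-p2's inertia kit (pencil language `∑ₖ X^{dₖ}Sₖ`) and val-sym-lift-p2 g15's Jacobi–Sturm rule; consumed by `…UnitNegativeType`
(this seat: negative type of recessive-side zeros, exact window count).  Currency: letters `unitLetter m`, exponents `unitExponent d f m`
(`…UnitPencilDefs`, p635976); continuants `D_k = pathDet (fun _ => 1) d (fun _ => 1) f k`.  Proved here (all sizes, all exponents):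
* `unitLetter_isSymm`, `unitPencil_apply_gen` / `unitPencil_apply` / `pencil_apply` (entries: diagonal, two links, zero off the band),
  `unitPencil_eq_ctPath` (the evaluated pencil IS the evaluated unit path matrix of `…TridiagonalSturmCertificate`, coefficients `1`),
  `det_unitPencil` (its polynomial determinant is `D_m`);
* `pencil_mulVec` (three-term action), `dot_pencil` (quadratic form `uᵀ(∑φ•S)u = Σ φ_d u² + 2Σ φ_l u u'` in `ℕ`-indexed currency),
  `kernel_eq_smul` (at `t > 0` every kernel vector of the evaluated pencil is `u_0 · w`, `w_i = (−1)^i D_i(t)/t^{F_i}`: forward substitution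
  along the non-zero links);
* `rayleigh_derivative_eval` — for the kit's Rayleigh polynomial `P_u = ∑κ (uᵀS_κu)X^{e_κ}`: `t·P_u′(t) = uᵀ(∑κ e_κt^{e_κ}•S_κ)u`.
Nothing here is an upper law for the register (α NO MOVER); nothing bears on `WeakLifting` / `TropicalB` (stmt-19771) in their windows,
Conjecture B, the Door-A registers, `MatrixDescartes` (stmt-18050) or VP ≠ VNP.
[this seat; folklore: Jacobi matrices as pencils of elementary letters]
-/

-- `Summit.ValiantsHypothesis.ValiantsHypothesis.…` repeats a component by the D-0017 layout (single-conjunct summit); the name is mandated.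
set_option linter.dupNamespace false
set_option autoImplicit false

namespace Summit.ValiantsHypothesis.ValiantsHypothesis.Theorems.KPlusLogSqLaw
namespace StaticTridiagonalRealUnit

open Real Finset Polynomial Matrix
open Summit.ValiantsHypothesis.ValiantsHypothesis.Theorems.KPlusLogSqLaw.StaticTridiagonalRealPotential (pathDet)
open Summit.ValiantsHypothesis.ValiantsHypothesis.Theorems.ValuativeFlip (ctPath ctPath_apply)

variable (d : ℕ → ℕ) (f : ℕ → ℕ)

/-! ### 1. The pencil is the unit path matrix -/

/-- the letters are symmetric. [this file] -/
theorem unitLetter_isSymm (m : ℕ) : ∀ κ, (unitLetter m κ).IsSymm := by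
  intro κ
  rcases κ with i | k
  · ext a b
    simp only [unitLetter, transpose_apply, of_apply]
    simp only [and_comm]
  · ext a b
    simp only [unitLetter, transpose_apply, of_apply]
    congr 1
    simp only [or_comm, and_comm]

/-- entries of the pencil with arbitrary coefficients (any `ℝ`-algebra): diagonal `φ(inl a)`, links `φ(inr ·)`, zero off the band. [this file] -/
theorem unitPencil_apply_gen {R : Type*} [CommRing R] [Algebra ℝ R] (m : ℕ) (φ : Fin m ⊕ Fin m → R) (a b : Fin m) :
    (∑ κ, φ κ • (unitLetter m κ).map (algebraMap ℝ R)) a b =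
      if (b : ℕ) = a then φ (Sum.inl a) else if (b : ℕ) = (a : ℕ) + 1 then φ (Sum.inr a)
        else if (a : ℕ) = (b : ℕ) + 1 then φ (Sum.inr b) else 0 := by
  have hite : ∀ (c : Prop) [Decidable c] (r : R), r * algebraMap ℝ R (if c then 1 else 0) = if c then r else 0 := by
    intro c _ r; split_ifs <;> simp
  rw [Matrix.sum_apply]
  simp only [Matrix.smul_apply, Matrix.map_apply, smul_eq_mul]
  rw [Fintype.sum_sum_type]
  simp only [unitLetter, Matrix.of_apply, hite]
  -- diagonal part
  have h1 : ∑ i : Fin m, (if a = i ∧ b = i then φ (Sum.inl i) else 0) = if (b : ℕ) = a then φ (Sum.inl a) else 0 := by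
    rw [Finset.sum_eq_single a]
    · by_cases hb : (b : ℕ) = a
      · rw [if_pos ⟨rfl, Fin.ext hb⟩, if_pos hb]
      · rw [if_neg (fun h => hb (by rw [h.2])), if_neg hb]
    · intro i _ hi; rw [if_neg (fun h => hi h.1.symm)]
    · intro h; exact absurd (Finset.mem_univ a) h
  -- link part
  have h2 : ∑ k : Fin m, (if ((a : ℕ) = k ∧ (b : ℕ) = (k : ℕ) + 1) ∨ ((a : ℕ) = (k : ℕ) + 1 ∧ (b : ℕ) = k) then φ (Sum.inr k) else 0) =
      if (b : ℕ) = (a : ℕ) + 1 then φ (Sum.inr a) else if (a : ℕ) = (b : ℕ) + 1 then φ (Sum.inr b) else 0 := by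
    by_cases hba : (b : ℕ) = (a : ℕ) + 1
    · rw [if_pos hba, Finset.sum_eq_single a]
      · rw [if_pos (Or.inl ⟨rfl, hba⟩)]
      · intro k _ hk
        have : (a : ℕ) ≠ k := fun h => hk (Fin.ext h.symm)
        rw [if_neg (by omega)]
      · intro h; exact absurd (Finset.mem_univ a) h
    · rw [if_neg hba]
      by_cases hab : (a : ℕ) = (b : ℕ) + 1
      · rw [if_pos hab, Finset.sum_eq_single b]
        · rw [if_pos (Or.inr ⟨hab, rfl⟩)]
        · intro k _ hk
          have : (b : ℕ) ≠ k := fun h => hk (Fin.ext h.symm)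
          rw [if_neg (by omega)]
        · intro h; exact absurd (Finset.mem_univ b) h
      · rw [if_neg hab]
        exact Finset.sum_eq_zero fun k _ => by rw [if_neg (by omega)]
  rw [h1, h2]
  by_cases hb : (b : ℕ) = a
  · rw [if_pos hb, if_pos hb, if_neg (by omega), if_neg (by omega), add_zero]
  · rw [if_neg hb, if_neg hb, zero_add]

/-- entries of the evaluated pencil: `x^{d_a}` on the diagonal, `x^{f}` on the two links, `0` off the band. [this file] -/
theorem unitPencil_apply (m : ℕ) (x : ℝ) (a b : Fin m) :
    (∑ κ, x ^ unitExponent d f m κ • unitLetter m κ) a b =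
      if (b : ℕ) = a then x ^ d a else if (b : ℕ) = (a : ℕ) + 1 then x ^ f a
        else if (a : ℕ) = (b : ℕ) + 1 then x ^ f b else 0 := by
  have h := unitPencil_apply_gen (R := ℝ) m (fun κ => x ^ unitExponent d f m κ) a b
  have hmap : ∀ κ, (unitLetter m κ).map (algebraMap ℝ ℝ) = unitLetter m κ := fun κ => by
    ext i j; simp
  simp only [hmap] at h
  rw [h]
  rfl

/-- the evaluated pencil IS the evaluated unit path matrix of `…TridiagonalSturmCertificate` (coefficients `a = b = 1`). [this file] -/
theorem unitPencil_eq_ctPath (m : ℕ) (x : ℝ) :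
    (∑ κ, x ^ unitExponent d f m κ • unitLetter m κ) =
      ctPath (fun t => (1 : ℝ) * x ^ d t) (fun t => (1 : ℝ) * x ^ f t) (fun t => (fun s => (1 : ℝ) * x ^ f s) (t - 1)) m := by
  ext a b
  rw [unitPencil_apply, ctPath_apply]
  by_cases h1 : (b : ℕ) = a
  · rw [if_pos h1, if_pos h1, one_mul]
  · rw [if_neg h1, if_neg h1]
    by_cases h2 : (b : ℕ) = (a : ℕ) + 1
    · rw [if_pos h2, if_pos h2, one_mul]
    · rw [if_neg h2, if_neg h2]
      by_cases h3 : (a : ℕ) = (b : ℕ) + 1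
      · rw [if_pos h3, if_pos h3]
        simp only [one_mul]
        rw [show (a : ℕ) - 1 = (b : ℕ) by omega]
      · rw [if_neg h3, if_neg h3]

/-- the determinant of the polynomial pencil is the continuant `D_m`. [this file] -/
theorem det_unitPencil (m : ℕ) :
    (∑ κ, (X : ℝ[X]) ^ unitExponent d f m κ • (unitLetter m κ).map C).det = pathDet (fun _ => (1 : ℝ)) d (fun _ => (1 : ℝ)) f m := by
  unfold pathDet
  congr 1
  refine Matrix.ext fun a b => ?_
  have h := unitPencil_apply_gen (R := ℝ[X]) m (fun κ => (X : ℝ[X]) ^ unitExponent d f m κ) a b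
  rw [Polynomial.algebraMap_eq] at h
  rw [h, ctPath_apply]
  by_cases h1 : (b : ℕ) = a
  · rw [if_pos h1, if_pos h1, map_one, one_mul]; rfl
  · rw [if_neg h1, if_neg h1]
    by_cases h2 : (b : ℕ) = (a : ℕ) + 1
    · rw [if_pos h2, if_pos h2, map_one, one_mul]; rfl
    · rw [if_neg h2, if_neg h2]
      by_cases h3 : (a : ℕ) = (b : ℕ) + 1
      · rw [if_pos h3, if_pos h3, map_one, one_mul]
        show (X : ℝ[X]) ^ f b = X ^ f ((a : ℕ) - 1)
        rw [show (a : ℕ) - 1 = (b : ℕ) by omega]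
      · rw [if_neg h3, if_neg h3]

/-! ### 2. Kernel vectors are multiples of the continuant vector -/

/-- entries of the pencil with arbitrary real coefficients `φ`. [this file] -/
theorem pencil_apply (m : ℕ) (φ : Fin m ⊕ Fin m → ℝ) (a b : Fin m) :
    (∑ κ, φ κ • unitLetter m κ) a b =
      if (b : ℕ) = a then φ (Sum.inl a) else if (b : ℕ) = (a : ℕ) + 1 then φ (Sum.inr a)
        else if (a : ℕ) = (b : ℕ) + 1 then φ (Sum.inr b) else 0 := by
  have h := unitPencil_apply_gen (R := ℝ) m φ a b
  have hmap : ∀ κ, (unitLetter m κ).map (algebraMap ℝ ℝ) = unitLetter m κ := fun κ => by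
    ext i j; simp
  simp only [hmap] at h
  exact h

/-- the pencil with coefficients `φ` acts as the three-term operator: row `a` reads
`φ(a,a)u_a + φ(a,a+1)u_{a+1} + φ(a−1,a)u_{a−1}`. [this file] -/
theorem pencil_mulVec (m : ℕ) (φ : Fin m ⊕ Fin m → ℝ) (u : Fin m → ℝ) (a : Fin m) :
    ((∑ κ, φ κ • unitLetter m κ) *ᵥ u) a =
      φ (Sum.inl a) * u a + (if h : (a : ℕ) + 1 < m then φ (Sum.inr a) * u ⟨(a : ℕ) + 1, h⟩ else 0) +
        (if h : 0 < (a : ℕ) then φ (Sum.inr ⟨(a : ℕ) - 1, by omega⟩) * u ⟨(a : ℕ) - 1, by omega⟩ else 0) := by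
  rw [Matrix.mulVec, dotProduct]
  simp_rw [pencil_apply]
  have hsplit : ∀ b : Fin m, (if (b : ℕ) = a then φ (Sum.inl a) else if (b : ℕ) = (a : ℕ) + 1 then φ (Sum.inr a)
        else if (a : ℕ) = (b : ℕ) + 1 then φ (Sum.inr b) else 0) * u b =
      (if (b : ℕ) = a then φ (Sum.inl a) * u b else 0) + (if (b : ℕ) = (a : ℕ) + 1 then φ (Sum.inr a) * u b else 0) +
        (if (a : ℕ) = (b : ℕ) + 1 then φ (Sum.inr b) * u b else 0) := by
    intro b
    by_cases h1 : (b : ℕ) = a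
    · rw [if_pos h1, if_pos h1, if_neg (by omega), if_neg (by omega)]; ring
    · rw [if_neg h1, if_neg h1]
      by_cases h2 : (b : ℕ) = (a : ℕ) + 1
      · rw [if_pos h2, if_pos h2, if_neg (by omega)]; ring
      · rw [if_neg h2, if_neg h2]
        by_cases h3 : (a : ℕ) = (b : ℕ) + 1
        · rw [if_pos h3, if_pos h3]; ring
        · rw [if_neg h3, if_neg h3]; ring
  simp_rw [hsplit]
  rw [sum_add_distrib, sum_add_distrib]
  congr 1
  congr 1
  · rw [Finset.sum_eq_single a]
    · rw [if_pos rfl]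
    · intro b _ hb; rw [if_neg (fun h => hb (Fin.ext h))]
    · intro h; exact absurd (Finset.mem_univ a) h
  · by_cases h : (a : ℕ) + 1 < m
    · rw [dif_pos h, Finset.sum_eq_single ⟨(a : ℕ) + 1, h⟩]
      · rw [if_pos rfl]
      · intro b _ hb; rw [if_neg (fun h' => hb (Fin.ext h'))]
      · intro h'; exact absurd (Finset.mem_univ _) h'
    · rw [dif_neg h]
      exact Finset.sum_eq_zero fun b _ => by rw [if_neg (by omega)]
  · by_cases h : 0 < (a : ℕ)
    · rw [dif_pos h, Finset.sum_eq_single ⟨(a : ℕ) - 1, by omega⟩]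
      · rw [if_pos (by simp only; omega)]
      · intro b _ hb
        rw [if_neg]
        intro h'
        exact hb (Fin.ext (by simp only; omega))
      · intro h'; exact absurd (Finset.mem_univ _) h'
    · rw [dif_neg h]
      exact Finset.sum_eq_zero fun b _ => by rw [if_neg (by omega)]

/-- **quadratic form of the pencil** in `ℕ`-indexed currency: `uᵀ(∑ φ•S)u = Σ_{j<m} φ_d(j) u_j² + 2Σ_{j<m−1} φ_l(j) u_j u_{j+1}`. [this file] -/
theorem dot_pencil (m : ℕ) (hm : 1 ≤ m) (φ : Fin m ⊕ Fin m → ℝ) (u : Fin m → ℝ) (v : ℕ → ℝ) (φd φl : ℕ → ℝ)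
    (hv : ∀ a : Fin m, u a = v a) (hφd : ∀ a : Fin m, φ (Sum.inl a) = φd a)
    (hφl : ∀ a : Fin m, φ (Sum.inr a) = φl a) :
    u ⬝ᵥ ((∑ κ, φ κ • unitLetter m κ) *ᵥ u) =
      ∑ j ∈ range m, φd j * v j ^ 2 + 2 * ∑ j ∈ range (m - 1), φl j * v j * v (j + 1) := by
  obtain ⟨n, rfl⟩ : ∃ n, m = n + 1 := ⟨m - 1, by omega⟩
  rw [Nat.add_sub_cancel, dotProduct]
  simp_rw [pencil_mulVec]
  simp only [mul_add, sum_add_distrib]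
  -- the three sums in `ℕ`-indexed form
  have h1 : ∑ a : Fin (n + 1), u a * (φ (Sum.inl a) * u a) = ∑ j ∈ range (n + 1), φd j * v j ^ 2 := by
    rw [← Fin.sum_univ_eq_sum_range]
    exact Finset.sum_congr rfl fun a _ => by rw [hv, hφd]; ring
  have h2 : ∑ a : Fin (n + 1), u a * (if h : (a : ℕ) + 1 < n + 1 then φ (Sum.inr a) * u ⟨(a : ℕ) + 1, h⟩ else 0) =
      ∑ j ∈ range n, φl j * v j * v (j + 1) := by
    have e := Fin.sum_univ_eq_sum_range (fun j : ℕ => if j + 1 < n + 1 then φl j * v j * v (j + 1) else 0) (n + 1)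
    beta_reduce at e
    rw [sum_range_succ, if_neg (by omega), add_zero] at e
    have step : ∑ a : Fin (n + 1), u a * (if h : (a : ℕ) + 1 < n + 1 then φ (Sum.inr a) * u ⟨(a : ℕ) + 1, h⟩ else 0) =
        ∑ i : Fin (n + 1), (if (i : ℕ) + 1 < n + 1 then φl i * v i * v ((i : ℕ) + 1) else 0) := by
      refine Finset.sum_congr rfl fun a _ => ?_
      by_cases h : (a : ℕ) + 1 < n + 1
      · simp only [dif_pos h, if_pos h]
        rw [hv, hφl, hv ⟨(a : ℕ) + 1, h⟩]; ring
      · simp only [dif_neg h, if_neg h, mul_zero]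
    rw [step, e]
    exact Finset.sum_congr rfl fun j hj => by rw [mem_range] at hj; rw [if_pos (by omega)]
  have h3 : ∑ a : Fin (n + 1), u a * (if h : 0 < (a : ℕ) then φ (Sum.inr ⟨(a : ℕ) - 1, by omega⟩) * u ⟨(a : ℕ) - 1, by omega⟩
        else 0) = ∑ j ∈ range n, φl j * v j * v (j + 1) := by
    have e := Fin.sum_univ_eq_sum_range (fun j : ℕ => if 0 < j then φl (j - 1) * v (j - 1) * v j else 0) (n + 1)
    beta_reduce at e
    rw [sum_range_succ', if_neg (lt_irrefl 0), add_zero] at e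
    have step : ∑ a : Fin (n + 1), u a * (if h : 0 < (a : ℕ) then φ (Sum.inr ⟨(a : ℕ) - 1, by omega⟩) * u ⟨(a : ℕ) - 1, by omega⟩
        else 0) = ∑ i : Fin (n + 1), (if 0 < (i : ℕ) then φl ((i : ℕ) - 1) * v ((i : ℕ) - 1) * v i else 0) := by
      refine Finset.sum_congr rfl fun a _ => ?_
      by_cases h : 0 < (a : ℕ)
      · simp only [dif_pos h, if_pos h]
        rw [hv, hφl, hv ⟨(a : ℕ) - 1, _⟩]; ring
      · simp only [dif_neg h, if_neg h, mul_zero]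
    rw [step, e]
    exact Finset.sum_congr rfl fun j _ => by rw [if_pos (Nat.succ_pos j), Nat.add_sub_cancel]
  rw [h1, h2, h3]
  ring

/-- **kernel vectors are multiples of the continuant vector**: at `t > 0`, if the evaluated pencil kills `u` then
`u_i = u_0 · (−1)^i D_i(t)/t^{F_i}` for every `i < m` (forward substitution along the non-zero links `t^{f}`). [this file] -/
theorem kernel_eq_smul (m : ℕ) (t : ℝ) (ht : 0 < t) (u : Fin m → ℝ)
    (hu : (∑ κ, t ^ unitExponent d f m κ • unitLetter m κ) *ᵥ u = 0) :
    ∀ i (hi : i < m), u ⟨i, hi⟩ = u ⟨0, by omega⟩ *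
      ((-1) ^ i * (pathDet (fun _ => (1 : ℝ)) d (fun _ => (1 : ℝ)) f i).eval t / t ^ (∑ j ∈ range i, f j)) := by
  have hrow : ∀ a : Fin m, t ^ d a * u a + (if h : (a : ℕ) + 1 < m then t ^ f a * u ⟨(a : ℕ) + 1, h⟩ else 0) +
      (if h : 0 < (a : ℕ) then t ^ f ((a : ℕ) - 1) * u ⟨(a : ℕ) - 1, by omega⟩ else 0) = 0 := by
    intro a
    have h := pencil_mulVec m (fun κ => t ^ unitExponent d f m κ) u a
    rw [hu] at h
    exact h.symm
  intro i
  induction i using Nat.strong_induction_on with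
  | _ i ih =>
    intro hi
    rcases i with _ | i
    · obtain ⟨e0, -⟩ := eval_unit_zero_one d f t
      simp [e0]
    rcases i with _ | i
    · -- row 0 determines u_1
      have h0 := hrow ⟨0, by omega⟩
      simp only [Nat.zero_add, show (0 : ℕ) + 1 < m from hi, dif_pos, lt_irrefl, dif_neg, not_false_eq_true,
        add_zero] at h0
      obtain ⟨-, e1⟩ := eval_unit_zero_one d f t
      rw [sum_range_one, pow_one, e1]
      have htf : t ^ f 0 ≠ 0 := pow_ne_zero _ ht.ne'
      field_simp
      linear_combination h0
    · -- row i+1 determines u_{i+2}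
      have h1 := ih (i + 1) (by omega) (by omega)
      have h2 := ih i (by omega) (by omega)
      have hr := hrow ⟨i + 1, by omega⟩
      simp only [show i + 1 + 1 < m from hi, dif_pos, Nat.succ_pos, Nat.add_sub_cancel] at hr
      have hw := kernelVec_row_succ d f t ht i
      rw [h1, h2] at hr
      have htf : t ^ f (i + 1) ≠ 0 := pow_ne_zero _ ht.ne'
      have hF : t ^ (∑ j ∈ range i, f j) ≠ 0 := pow_ne_zero _ ht.ne'
      have hF1 : t ^ (∑ j ∈ range (i + 1), f j) ≠ 0 := pow_ne_zero _ ht.ne'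
      have hF2 : t ^ (∑ j ∈ range (i + 2), f j) ≠ 0 := pow_ne_zero _ ht.ne'
      -- isolate `u_{i+2}`
      have key : t ^ f (i + 1) * u ⟨i + 1 + 1, hi⟩ =
          t ^ f (i + 1) * (u ⟨0, by omega⟩ * ((-1) ^ (i + 2) *
            (pathDet (fun _ => (1 : ℝ)) d (fun _ => (1 : ℝ)) f (i + 2)).eval t / t ^ (∑ j ∈ range (i + 2), f j))) := by
        linear_combination hr - u ⟨0, by omega⟩ * hw
      exact mul_left_cancel₀ htf key

/-! ### 3. The Rayleigh derivative of the kit is the Hellmann–Feynman form -/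

/-- `t · P_u′(t) = uᵀ(∑ κ, e_κ t^{e_κ} • S_κ)u` for the Rayleigh polynomial `P_u = ∑ κ (uᵀS_κu) X^{e_κ}` of the kit. [this file] -/
theorem rayleigh_derivative_eval (m : ℕ) (u : Fin m → ℝ) (t : ℝ) :
    t * (derivative (∑ κ, C (u ⬝ᵥ (unitLetter m κ *ᵥ u)) * (X : ℝ[X]) ^ unitExponent d f m κ)).eval t =
      u ⬝ᵥ ((∑ κ, ((unitExponent d f m κ : ℝ) * t ^ unitExponent d f m κ) • unitLetter m κ) *ᵥ u) := by
  rw [derivative_sum, eval_finsetSum, Finset.mul_sum, Matrix.sum_mulVec, dotProduct_sum]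
  refine Finset.sum_congr rfl fun κ _ => ?_
  rw [derivative_C_mul_X_pow, eval_mul, eval_C, eval_pow, eval_X, Matrix.smul_mulVec, dotProduct_smul, smul_eq_mul]
  have h := Summit.ValiantsHypothesis.ValiantsHypothesis.Theorems.LacunarySymmetroidMatrixDescartes.SecularRolle.mul_natCast_mul_pow_pred
    t (unitExponent d f m κ)
  linear_combination (u ⬝ᵥ (unitLetter m κ *ᵥ u)) * h

end StaticTridiagonalRealUnit
end Summit.ValiantsHypothesis.ValiantsHypothesis.Theorems.KPlusLogSqLaw
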